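import Literature.NumberTheory.LFunctions.WeilSemilocalWindow
import Literature.NumberTheory.LFunctions.WeilSemilocalEventuallyNegative
import Summits.RiemannHypothesis.RiemannHypothesis.Theorems.MotivicDoorRungs
import Summits.RiemannHypothesis.RiemannHypothesis.Theorems.MotivicDoorSemilocalClosed
import HarnessLib

/-!
# Motivic door — the semi-local threshold `a*(S)`: every finite set of places has a closed initial segment of Weil-positive windows (pub-rhdoor seat lad-2, rung R3, part 2/2)

HONEST FRAMING (verbatim, governs every line below): lottery ticket at the motivic door; RH probability
negligible; consolation prizes are real: a new semi-local Weil-positivity theorem, or a located gap in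
the Connes–Consani programme, plus the ff-door theorem.  This file makes NO claim about `ζ` beyond the
tree's theorems it cites by name.

The object (`Literature/NumberTheory/LFunctions/WeilSemilocalQuadratic.lean`): for a finite set of primes
`S` (the places `S ∪ {∞}`), `Q_S(g) = W_S(g ⋆ g̃)` is Weil's quadratic form with the prime sum restricted to
the `S`-smooth prime powers, and `WeilSemilocalPositivityOn S a` says `Re Q_S(g) ≥ 0` for every test
function `g ∈ C(a)`.  The tree already proves: positivity of the `{∞,2}` form on `C((log 3)/2)` and on
`C(563/1024)` (`weilSemilocalPositivityOn_two_log_three_half`, `…_two_certb`), its FAILURE on every window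
`a ≥ log 2` (`not_weilSemilocalPositivityOn_two_of_log_two_le`, an odd test function), for EVERY finite
`S` failure on all large windows (`bddAbove_setOf_weilSemilocalPositivityOn`), and (part 1/2,
`MotivicDoorSemilocalClosed.lean`) locality in `S` and closedness of the set of positive windows.

## What is proved here (everything PROVED, standard axioms; one new real number, no named facts)

* §3 THE THRESHOLD `a*(S) := sup {a > 0 : WeilSemilocalPositivityOn S a}` (`weilSemilocalThreshold`), an
  honest real number for EVERY finite `S` (the set contains `(log 2)/2` and is bounded, unconditionally;
  contrast Yoshida's `a₀`, a junk `sSup` when RH holds): for every real `a`,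
  `WeilSemilocalPositivityOn S a ↔ a ≤ a*(S)` (`weilSemilocalPositivityOn_iff_le_weilSemilocalThreshold`;
  the maximum is ATTAINED, by closedness), with `(log 2)/2 ≤ a*(S)` always, `(log 3)/2 ≤ a*(S)` if
  `2 ∈ S`, `59/100 ≤ a*(S)` if `2, 3 ∈ S`, and for `2 ∈ S ∌ 3`: `a*(S) = a*({2}) ∈ [563/1024, log 2)`
  (`weilSemilocalThreshold_eq_two`, `weilSemilocalThreshold_two_mem_Ico`; in decimals
  `0.5498 ≤ a*({2}) < 0.6932`, `weilSemilocalThreshold_two_bounds`).  Thresholds are LOCAL in `S`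
  (`weilSemilocalThreshold_congr`).  DATA (not used in any statement; two engines, cell file
  `LADDER-R3.md` §1/§4): `a*({2}) ≈ 0.5578`.
* §4 THE DOOR IN THRESHOLD LANGUAGE: `RH → (log (N+1))/2 ≤ a*(S)` whenever every prime `≤ N` is in `S`
  (`le_weilSemilocalThreshold_of_riemannHypothesis`), so a semi-local threshold found BELOW its
  coincidence window would refute RH (`not_riemannHypothesis_of_weilSemilocalThreshold_lt`; for `S = {2}`
  the window is `(log 3)/2 = 0.5493… < 0.5498 ≤ a*({2})` — shut, PROVED:
  `log_three_half_lt_weilSemilocalThreshold_two`); `RH ↔ ∀ N, (log (N+1))/2 ≤ a*(primes ≤ N)`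
  (`riemannHypothesis_iff_forall_le_weilSemilocalThreshold`, the ladder `R∞` of `MotivicDoorRungs`
  restated); and under `¬RH` Yoshida's threshold `a₀` and `a*(S)` agree below the coincidence window:
  `min (a*(S)) L = min a₀ L`, `L = (log (N+1))/2` (`min_weilSemilocalThreshold_eq`), hence
  `a*(S) < L → a*(S) = a₀`, and unconditionally `RH ∨ L ≤ a*(S) ∨ a*(S) = a₀` (`riemannHypothesis_or_le_or_eq`).

References: H. Yoshida, Adv. Stud. Pure Math. 21 (1992), Thm 1 p. 310, Prop. 6 p. 320 (threshold and
closedness for the full form; `Yoshida1992HermitianForms`); E. Bombieri, Rend. Mat. Acc. Lincei (9) 11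
(2000) §4 (`Bombieri2000Weil`); A. Connes, Selecta Math. 5 (1999) §VII Thm 4 (`Connes1999`); A. Connes,
C. Consani, Selecta Math. 27 (2021) (the archimedean place).  The semi-local threshold statements are, as
far as we searched (cell file `LADDER-R3.md` §2–§3), not in print: new theorems about the tree's object,
labelled PROVED-new in the cell's MANIFEST, not literature.
-/

set_option linter.dupNamespace false  -- the mandated namespace repeats `RiemannHypothesis`

noncomputable section

open Filter Set Metric Literature.NumberTheory.LFunctions
open Summit.RiemannHypothesis.RiemannHypothesis.Theorems.MotivicDoor.Semilocal
open scoped Topology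

namespace Summit.RiemannHypothesis.RiemannHypothesis.Theorems.MotivicDoor.SemilocalThreshold

variable {g : ℝ → ℂ} {S S' : Finset ℕ}

/-! ## §3  The semi-local threshold `a*(S)` -/

/-- **The semi-local threshold** `a*(S) := sup {a > 0 : WeilSemilocalPositivityOn S a}` — the semi-local
analogue of Yoshida's `a₀` (1992, Prop. 6).  Unlike `a₀` it is unconditionally the maximum of a
non-empty bounded set (`isGreatest_weilSemilocalThreshold`). [cite: Yoshida1992HermitianForms, Prop. 6 (p. 320) — the definition of a₀, with the primes restricted to S] -/
def weilSemilocalThreshold (S : Finset ℕ) : ℝ :=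
  sSup {a : ℝ | 0 < a ∧ WeilSemilocalPositivityOn S a}

/-- **Every semi-local form is positive on `C((log 2)/2)`** (no prime power is visible there, so
`Q_S = Q`, and Yoshida's Theorem 1 = the tree's `weilPositivityOn_log_two_half_holds` applies).
[cite: Yoshida1992HermitianForms, Thm. 1 (p. 310)] -/
theorem weilSemilocalPositivityOn_log_two_half (S : Finset ℕ) :
    WeilSemilocalPositivityOn S (Real.log 2 / 2) := by
  have hS : ∀ n ≤ 1, IsPrimePow n → n.primeFactors ⊆ S := fun n hn hp ↦ by
    have := hp.two_le; omega
  have e : Real.log (((1 : ℕ) : ℝ) + 1) / 2 = Real.log 2 / 2 := by norm_num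
  have h := weilSemilocalPositivityOn_iff_weilPositivityOn_of_forall hS
  rw [e] at h
  exact h.2 weilPositivityOn_log_two_half_holds

/-- For `2 ∈ S` the semi-local form is positive on `C((log 3)/2)` (there `Q_S = Q`; first-prime rung
`weilPositivityOn_log_three_half`). [cite: Yoshida1992HermitianForms, Thm. 1 (p. 310) and §6 (method)] -/
theorem weilSemilocalPositivityOn_log_three_half (h2 : 2 ∈ S) :
    WeilSemilocalPositivityOn S (Real.log 3 / 2) := by
  have hS : ∀ n ≤ 2, IsPrimePow n → n.primeFactors ⊆ S := fun n hn hp ↦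
    (primeFactors_subset_two_of_le_two n hn hp).trans (Finset.singleton_subset_iff.2 h2)
  have e : Real.log (((2 : ℕ) : ℝ) + 1) / 2 = Real.log 3 / 2 := by norm_num
  have h := weilSemilocalPositivityOn_iff_weilPositivityOn_of_forall hS
  rw [e] at h
  exact h.2 weilPositivityOn_log_three_half

/-- For `2, 3 ∈ S` the semi-local form is positive on `C(59/100)` (there `Q_S = Q`, `59/100 < (log 5)/2`;
two-prime rung `weilPositivityOn_59_100`). [cite: Bombieri2000Weil, §4 (criterion); certificate in tree] -/
theorem weilSemilocalPositivityOn_59_100 (h2 : 2 ∈ S) (h3 : 3 ∈ S) :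
    WeilSemilocalPositivityOn S (59 / 100) := by
  have h23 : ({2, 3} : Finset ℕ) ⊆ S := by
    intro p hp
    simp only [Finset.mem_insert, Finset.mem_singleton] at hp
    rcases hp with rfl | rfl
    · exact h2
    · exact h3
  have hS : ∀ n ≤ 4, IsPrimePow n → n.primeFactors ⊆ S := fun n hn hp ↦
    (primeFactors_subset_of_le_four n hn hp).trans h23
  have ha : (59 / 100 : ℝ) ≤ Real.log (((4 : ℕ) : ℝ) + 1) / 2 := by
    rw [log_five_half_eq]
    linarith [log_two_le_log_five_half, Real.log_two_gt_d9]
  exact (weilSemilocalPositivityOn_iff_weilPositivityOn_of_le hS ha).2 weilPositivityOn_59_100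

/-- For `2 ∈ S ∌ 3`, semi-local positivity at `S` and at `{2}` agree on every window `a ≤ (log 5)/2`. [folklore] -/
theorem weilSemilocalPositivityOn_iff_two (h2 : 2 ∈ S) (h3 : 3 ∉ S) {a : ℝ} (ha : a ≤ Real.log 5 / 2) :
    WeilSemilocalPositivityOn S a ↔ WeilSemilocalPositivityOn {2} a :=
  weilSemilocalPositivityOn_congr (primeFactors_iff_two_of_le_four h2 h3) (by rwa [log_five_half_eq])

/-- For `2 ∈ S ∌ 3` the semi-local form is positive on `C(563/1024)` (Stage-C certificate for the `{∞,2}`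
form, `weilSemilocalPositivityOn_two_certb`). [cite: Yoshida1992, Thm 1 (p. 310), §6 (method); certificate in tree] -/
theorem weilSemilocalPositivityOn_certb (h2 : 2 ∈ S) (h3 : 3 ∉ S) :
    WeilSemilocalPositivityOn S ((weilCert3C.b : ℚ) : ℝ) :=
  (weilSemilocalPositivityOn_iff_two h2 h3 (certb_le_log_two.trans log_two_le_log_five_half)).2
    weilSemilocalPositivityOn_two_certb

/-- For `2 ∈ S ∌ 3` the semi-local form FAILS on every cone `C(a)`, `a ≥ log 2` (the odd Jensen-window
witness of `not_weilSemilocalPositivityOn_two_log_two` is supported in `[-log 2, log 2] ⊆ [-(log 5)/2, (log 5)/2]`,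
where `Q_S = Q_{{2}}`). [folklore] -/
theorem not_weilSemilocalPositivityOn_of_log_two_le (h2 : 2 ∈ S) (h3 : 3 ∉ S) {a : ℝ}
    (ha : Real.log 2 ≤ a) : ¬ WeilSemilocalPositivityOn S a := fun h ↦
  not_weilSemilocalPositivityOn_two_log_two
    ((weilSemilocalPositivityOn_iff_two h2 h3 log_two_le_log_five_half).1 (h.mono ha))

/-- `(log 2)/2` is a positive semi-locally positive window, for every `S`. [cite: Yoshida1992HermitianForms, Thm. 1 (p. 310)] -/
theorem log_two_half_mem (S : Finset ℕ) :
    Real.log 2 / 2 ∈ {a : ℝ | 0 < a ∧ WeilSemilocalPositivityOn S a} :=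
  ⟨by positivity, weilSemilocalPositivityOn_log_two_half S⟩

/-- The set behind `a*(S)` is non-empty … [folklore] -/
theorem semilocalSet_nonempty (S : Finset ℕ) :
    {a : ℝ | 0 < a ∧ WeilSemilocalPositivityOn S a}.Nonempty :=
  ⟨_, log_two_half_mem S⟩

/-- … and bounded above (the tree's `bddAbove_setOf_weilSemilocalPositivityOn`: every finite `S` fails on
large windows). [folklore] -/
theorem bddAbove_semilocalSet (S : Finset ℕ) :
    BddAbove {a : ℝ | 0 < a ∧ WeilSemilocalPositivityOn S a} :=
  (bddAbove_setOf_weilSemilocalPositivityOn S).mono fun _ ha ↦ ha.2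

/-- `(log 2)/2 ≤ a*(S)` for every `S`. [cite: Yoshida1992HermitianForms, Thm. 1 (p. 310)] -/
theorem log_two_half_le_weilSemilocalThreshold (S : Finset ℕ) :
    Real.log 2 / 2 ≤ weilSemilocalThreshold S :=
  le_csSup (bddAbove_semilocalSet S) (log_two_half_mem S)

/-- `0 < a*(S)`. [folklore] -/
theorem weilSemilocalThreshold_pos (S : Finset ℕ) : 0 < weilSemilocalThreshold S :=
  lt_of_lt_of_le (by positivity) (log_two_half_le_weilSemilocalThreshold S)

/-- **The supremum is attained**: `Q_S ≥ 0` on `C(a*(S))` (closedness, §2). [folklore] -/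
theorem weilSemilocalPositivityOn_weilSemilocalThreshold (S : Finset ℕ) :
    WeilSemilocalPositivityOn S (weilSemilocalThreshold S) := by
  refine weilSemilocalPositivityOn_of_forall_lt (weilSemilocalThreshold_pos S) fun b hb hblt ↦ ?_
  obtain ⟨c, hc, hbc⟩ := exists_lt_of_lt_csSup (semilocalSet_nonempty S) hblt
  exact hc.2.mono hbc.le

/-- A semi-locally positive window lies below the threshold. [folklore] -/
theorem le_weilSemilocalThreshold {a : ℝ} (h : WeilSemilocalPositivityOn S a) :
    a ≤ weilSemilocalThreshold S := by
  by_cases ha : 0 < a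
  · exact le_csSup (bddAbove_semilocalSet S) ⟨ha, h⟩
  · exact (le_of_not_gt ha).trans (weilSemilocalThreshold_pos S).le

/-- **The semi-local threshold theorem**: for every finite set of primes `S` and every real `a`,
`Q_S ≥ 0` on `C(a)` iff `a ≤ a*(S)` — the semi-locally positive windows form the CLOSED initial segment
`(-∞, a*(S)]`. [folklore] -/
theorem weilSemilocalPositivityOn_iff_le_weilSemilocalThreshold {a : ℝ} :
    WeilSemilocalPositivityOn S a ↔ a ≤ weilSemilocalThreshold S :=
  ⟨le_weilSemilocalThreshold, fun h ↦ (weilSemilocalPositivityOn_weilSemilocalThreshold S).mono h⟩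

/-- Failure form: `Q_S` takes a negative value on `C(a)` iff `a*(S) < a`. [folklore] -/
theorem not_weilSemilocalPositivityOn_iff_weilSemilocalThreshold_lt {a : ℝ} :
    ¬ WeilSemilocalPositivityOn S a ↔ weilSemilocalThreshold S < a := by
  rw [weilSemilocalPositivityOn_iff_le_weilSemilocalThreshold, not_le]

/-- The set of semi-locally positive windows IS `Iic (a*(S))`. [folklore] -/
theorem setOf_weilSemilocalPositivityOn_eq_Iic (S : Finset ℕ) :
    {a : ℝ | WeilSemilocalPositivityOn S a} = Iic (weilSemilocalThreshold S) :=
  Set.ext fun _ ↦ weilSemilocalPositivityOn_iff_le_weilSemilocalThreshold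

/-- `a*(S)` is the greatest semi-locally positive window. [folklore] -/
theorem isGreatest_weilSemilocalThreshold (S : Finset ℕ) :
    IsGreatest {a : ℝ | WeilSemilocalPositivityOn S a} (weilSemilocalThreshold S) :=
  ⟨weilSemilocalPositivityOn_weilSemilocalThreshold S, fun _ h ↦ le_weilSemilocalThreshold h⟩

/-- Existence and uniqueness of the threshold as a characterising number. [folklore] -/
theorem existsUnique_weilSemilocalThreshold (S : Finset ℕ) :
    ∃! a₀ : ℝ, ∀ a : ℝ, WeilSemilocalPositivityOn S a ↔ a ≤ a₀ := by
  refine ⟨weilSemilocalThreshold S, fun a ↦ weilSemilocalPositivityOn_iff_le_weilSemilocalThreshold,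
    fun b hb ↦ le_antisymm ?_ ?_⟩
  · exact le_weilSemilocalThreshold ((hb b).2 le_rfl)
  · exact (hb _).1 (weilSemilocalPositivityOn_weilSemilocalThreshold S)

/-- **Thresholds are local in `S`**: if `S`, `S'` contain the same primes among those with a power `≤ N`
and `a*(S) < (log (N+1))/2`, then `a*(S') = a*(S)`. [folklore] -/
theorem weilSemilocalThreshold_congr {N : ℕ}
    (h : ∀ n ≤ N, IsPrimePow n → (n.primeFactors ⊆ S ↔ n.primeFactors ⊆ S'))
    (hlt : weilSemilocalThreshold S < Real.log ((N : ℝ) + 1) / 2) :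
    weilSemilocalThreshold S' = weilSemilocalThreshold S := by
  apply le_antisymm
  · by_contra hlt'
    rw [not_le] at hlt'
    have hb1 : WeilSemilocalPositivityOn S'
        (min (weilSemilocalThreshold S') (Real.log ((N : ℝ) + 1) / 2)) :=
      (weilSemilocalPositivityOn_weilSemilocalThreshold S').mono (min_le_left _ _)
    have hb2 := le_weilSemilocalThreshold ((weilSemilocalPositivityOn_congr h (min_le_right _ _)).2 hb1)
    have hb3 : weilSemilocalThreshold S <
        min (weilSemilocalThreshold S') (Real.log ((N : ℝ) + 1) / 2) := lt_min hlt' hlt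
    exact lt_irrefl _ (hb3.trans_le hb2)
  · exact le_weilSemilocalThreshold
      ((weilSemilocalPositivityOn_congr h hlt.le).1 (weilSemilocalPositivityOn_weilSemilocalThreshold S))

/-- `(log 3)/2 ≤ a*(S)` when `2 ∈ S`. [cite: Yoshida1992HermitianForms, Thm. 1 (p. 310) and §6] -/
theorem log_three_half_le_weilSemilocalThreshold (h2 : 2 ∈ S) :
    Real.log 3 / 2 ≤ weilSemilocalThreshold S :=
  le_weilSemilocalThreshold (weilSemilocalPositivityOn_log_three_half h2)

/-- `59/100 ≤ a*(S)` when `2, 3 ∈ S`. [cite: Bombieri2000Weil, §4; certificate in tree] -/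
theorem le_weilSemilocalThreshold_of_two_three (h2 : 2 ∈ S) (h3 : 3 ∈ S) :
    (59 / 100 : ℝ) ≤ weilSemilocalThreshold S :=
  le_weilSemilocalThreshold (weilSemilocalPositivityOn_59_100 h2 h3)

/-- `563/1024 ≤ a*(S)` when `2 ∈ S ∌ 3`. [cite: Yoshida1992, Thm 1 (p. 310), §6 (method); certificate in tree] -/
theorem certb_le_weilSemilocalThreshold (h2 : 2 ∈ S) (h3 : 3 ∉ S) :
    ((weilCert3C.b : ℚ) : ℝ) ≤ weilSemilocalThreshold S :=
  le_weilSemilocalThreshold (weilSemilocalPositivityOn_certb h2 h3)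

/-- `a*(S) < log 2` when `2 ∈ S ∌ 3`. [folklore] -/
theorem weilSemilocalThreshold_lt_log_two (h2 : 2 ∈ S) (h3 : 3 ∉ S) :
    weilSemilocalThreshold S < Real.log 2 :=
  not_weilSemilocalPositivityOn_iff_weilSemilocalThreshold_lt.1
    (not_weilSemilocalPositivityOn_of_log_two_le h2 h3 le_rfl)

/-- **Universality of the `{∞,2}` threshold**: `a*(S) = a*({2})` for every finite `S` with `2 ∈ S ∌ 3`
(thresholds are local, and `a*({2}) < log 2 ≤ (log 5)/2`). [folklore] -/
theorem weilSemilocalThreshold_eq_two (h2 : 2 ∈ S) (h3 : 3 ∉ S) :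
    weilSemilocalThreshold S = weilSemilocalThreshold {2} := by
  refine weilSemilocalThreshold_congr (N := 4) (fun n hn hp ↦ (primeFactors_iff_two_of_le_four h2 h3 n hn hp).symm) ?_
  rw [log_five_half_eq]
  exact (weilSemilocalThreshold_lt_log_two (Finset.mem_singleton_self 2) (by decide)).trans_le
    log_two_le_log_five_half

/-- **Rung R3 as one number**: `a*({2}) ∈ [563/1024, log 2)`. [folklore] -/
theorem weilSemilocalThreshold_two_mem_Ico :
    weilSemilocalThreshold {2} ∈ Ico (((weilCert3C.b : ℚ) : ℝ)) (Real.log 2) :=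
  ⟨certb_le_weilSemilocalThreshold (Finset.mem_singleton_self 2) (by decide),
    weilSemilocalThreshold_lt_log_two (Finset.mem_singleton_self 2) (by decide)⟩

/-- Decimal form: `0.5498 ≤ a*({2}) < 0.6932` (PROVED; DATA, not used: `a*({2}) ≈ 0.5578`). [folklore] -/
theorem weilSemilocalThreshold_two_bounds :
    (0.5498 : ℝ) ≤ weilSemilocalThreshold {2} ∧ weilSemilocalThreshold {2} < 0.6932 := by
  obtain ⟨h1, h2⟩ := weilSemilocalThreshold_two_mem_Ico
  have hb : weilCert3C.b = 563 / 1024 := by decide +kernel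
  rw [hb] at h1
  push_cast at h1
  have h3 := Real.log_two_lt_d9
  constructor <;> linarith

/-! ## §4  The door in threshold language -/

/-- **RH forces every semi-local threshold past its coincidence window**: if every prime `≤ N` lies in
`S` then `RH → (log (N+1))/2 ≤ a*(S)`. [cite: Bombieri2000Weil, §4 (Weil's criterion); Yoshida1992HermitianForms, Prop. 6] -/
theorem le_weilSemilocalThreshold_of_riemannHypothesis (hRH : Summit.RiemannHypothesis) {N : ℕ}
    (hS : ∀ n ≤ N, IsPrimePow n → n.primeFactors ⊆ S) :
    Real.log ((N : ℝ) + 1) / 2 ≤ weilSemilocalThreshold S := by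
  rcases Nat.eq_zero_or_pos N with rfl | hN
  · simp [(weilSemilocalThreshold_pos S).le]
  · have hpos : 0 < Real.log ((N : ℝ) + 1) / 2 := by
      have hN' : (1 : ℝ) < (N : ℝ) + 1 := by
        have : (0 : ℝ) < N := by exact_mod_cast hN
        linarith
      have := Real.log_pos hN'
      positivity
    exact le_weilSemilocalThreshold ((weilSemilocalPositivityOn_iff_weilPositivityOn_of_forall hS).2
      (Rungs.rung_of_riemannHypothesis hRH hpos))

/-- **The door test**: a semi-local threshold found strictly below its coincidence window refutes RH.
(For `S = {2}`, `N = 2`: the window is `(log 3)/2 = 0.5493… < 0.5498 ≤ a*({2})` — shut, PROVED.) [cite: Bombieri2000Weil, §4 (Weil's criterion)] -/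
theorem not_riemannHypothesis_of_weilSemilocalThreshold_lt {N : ℕ}
    (hS : ∀ n ≤ N, IsPrimePow n → n.primeFactors ⊆ S)
    (h : weilSemilocalThreshold S < Real.log ((N : ℝ) + 1) / 2) : ¬ Summit.RiemannHypothesis :=
  fun hRH ↦ lt_irrefl _ (h.trans_le (le_weilSemilocalThreshold_of_riemannHypothesis hRH hS))

/-- **`R∞` in threshold language**: RH holds iff, for every `N`, the threshold of the primes `≤ N`
reaches the window `(log (N+1))/2`. [cite: Yoshida1992HermitianForms, Prop. 6; Bombieri2000Weil, §4] -/
theorem riemannHypothesis_iff_forall_le_weilSemilocalThreshold :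
    Summit.RiemannHypothesis ↔
      ∀ N : ℕ, Real.log ((N : ℝ) + 1) / 2 ≤ weilSemilocalThreshold (Nat.primesBelow (N + 1)) := by
  rw [Rungs.riemannHypothesis_iff_forall_finitePrimeWindow]
  refine forall_congr' fun N ↦ ?_
  rw [← weilSemilocalPositivityOn_iff_weilPositivityOn_of_forall
      (S := Nat.primesBelow (N + 1)) (N := N) (fun n hn _ ↦ primeFactors_subset_primesBelow hn),
    weilSemilocalPositivityOn_iff_le_weilSemilocalThreshold]

/-- **Below the coincidence window, `a*(S)` and Yoshida's `a₀` are the same number** (under `¬RH`, where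
`a₀` is meaningful): `min (a*(S)) L = min a₀ L`, `L = (log (N+1))/2`, whenever every prime `≤ N` is in `S`.
[cite: Yoshida1992HermitianForms, Prop. 6 (p. 320)] -/
theorem min_weilSemilocalThreshold_eq (hRH : ¬ Summit.RiemannHypothesis) {N : ℕ}
    (hS : ∀ n ≤ N, IsPrimePow n → n.primeFactors ⊆ S) :
    min (weilSemilocalThreshold S) (Real.log ((N : ℝ) + 1) / 2) =
      min weilPositivityThreshold (Real.log ((N : ℝ) + 1) / 2) := by
  have ha₀ : 0 < weilPositivityThreshold :=
    lt_of_lt_of_le (by positivity) (Yoshida1992_prop6 hRH).1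
  have hL : 0 ≤ Real.log ((N : ℝ) + 1) / 2 := by
    have := Real.log_nonneg (show (1 : ℝ) ≤ (N : ℝ) + 1 by simp)
    positivity
  rcases hL.eq_or_lt with hL0 | hLpos
  · rw [← hL0, min_eq_right (weilSemilocalThreshold_pos S).le, min_eq_right ha₀.le]
  have key : ∀ a : ℝ, 0 < a → a ≤ Real.log ((N : ℝ) + 1) / 2 →
      (a ≤ weilSemilocalThreshold S ↔ a ≤ weilPositivityThreshold) := fun a ha haL ↦ by
    rw [← weilSemilocalPositivityOn_iff_le_weilSemilocalThreshold,
      weilSemilocalPositivityOn_iff_weilPositivityOn_of_le hS haL,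
      Rungs.weilPositivityOn_iff_le_threshold hRH ha]
  apply le_antisymm
  · have hm : 0 < min (weilSemilocalThreshold S) (Real.log ((N : ℝ) + 1) / 2) :=
      lt_min (weilSemilocalThreshold_pos S) hLpos
    exact le_min ((key _ hm (min_le_right _ _)).1 (min_le_left _ _)) (min_le_right _ _)
  · have hm : 0 < min weilPositivityThreshold (Real.log ((N : ℝ) + 1) / 2) := lt_min ha₀ hLpos
    exact le_min ((key _ hm (min_le_right _ _)).2 (min_le_left _ _)) (min_le_right _ _)

/-- Hence, under `¬RH`: a semi-local threshold below its coincidence window IS Yoshida's `a₀`.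
[cite: Yoshida1992HermitianForms, Prop. 6 (p. 320)] -/
theorem weilSemilocalThreshold_eq_weilPositivityThreshold (hRH : ¬ Summit.RiemannHypothesis) {N : ℕ}
    (hS : ∀ n ≤ N, IsPrimePow n → n.primeFactors ⊆ S)
    (h : weilSemilocalThreshold S < Real.log ((N : ℝ) + 1) / 2) :
    weilSemilocalThreshold S = weilPositivityThreshold := by
  have hmin := min_weilSemilocalThreshold_eq hRH hS
  rw [min_eq_left h.le] at hmin
  rcases le_total weilPositivityThreshold (Real.log ((N : ℝ) + 1) / 2) with h1 | h1
  · rwa [min_eq_left h1] at hmin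
  · rw [min_eq_right h1] at hmin
    exact absurd hmin h.ne

/-- UNCONDITIONAL trichotomy for every `S` containing the primes `≤ N`: RH, or `a*(S)` reaches the
coincidence window, or `a*(S)` is Yoshida's break point `a₀`. [cite: Yoshida1992HermitianForms, Prop. 6 (p. 320)] -/
theorem riemannHypothesis_or_le_or_eq {N : ℕ} (hS : ∀ n ≤ N, IsPrimePow n → n.primeFactors ⊆ S) :
    Summit.RiemannHypothesis ∨ Real.log ((N : ℝ) + 1) / 2 ≤ weilSemilocalThreshold S ∨
      weilSemilocalThreshold S = weilPositivityThreshold := by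
  by_cases hRH : Summit.RiemannHypothesis
  · exact Or.inl hRH
  · rcases le_or_gt (Real.log ((N : ℝ) + 1) / 2) (weilSemilocalThreshold S) with h | h
    · exact Or.inr (Or.inl h)
    · exact Or.inr (Or.inr (weilSemilocalThreshold_eq_weilPositivityThreshold hRH hS h))

/-- The `S = {2}` instance, `N = 2`: RH, or `a*({2}) = a₀` would have to hold with `a*({2}) < (log 3)/2` —
and the second is EXCLUDED by `563/1024 ≤ a*({2})`; so unconditionally `(log 3)/2 ≤ a*({2})` and the
`{∞,2}` threshold carries no information about RH (the door is shut at `S = {2}`). [folklore] -/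
theorem log_three_half_lt_weilSemilocalThreshold_two :
    Real.log 3 / 2 < weilSemilocalThreshold {2} := by
  have h3 := Real.log_three_lt_d9
  have hb := weilSemilocalThreshold_two_bounds.1
  linarith


end Summit.RiemannHypothesis.RiemannHypothesis.Theorems.MotivicDoor.SemilocalThreshold

end
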